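import Summits.QuantumFields.YangMills.Theorems.BalabanUVNodesK0PrintCubeOfStepTokensGridGuarded
import Literature.MathematicalPhysics.QuantumFieldTheory.Balaban1983to89.Node00.Record13LettersOfThm1CCMWZB
import Literature.MathematicalPhysics.QuantumFieldTheory.Balaban1983to89.Node00.Record13SepCoPLiveSelectorZ

/-!
# K0⁷ — THE ALL-TORUS K0 BODY UNDER V21-G's FOUR-CONJUNCT GRID GUARD `A‴(c, c₀, c₁)` AT DEF-1's Z3 WITNESS FAMILY `θ₁₅ᶜᶜᴹᵂᶻᴮ(j; γ; εbg; …; Efl, logz) = theta13OfThm1CCMWZB …`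
# (background radius `εbg` and print's letters `Efl, logz` OPEN), THE SIGN-FREE CLAUSES FROM ONE ABS β-BOX OF THE HALF-WINDOW MEMBER, PART 1-G‴ AND THE CANDIDATE COMPOSITION —
# k0-s1-w3's `…K0Stub1GridNumericsGuardWitness` §2–§3 + `…K0PrintCubeOfStepTokensGridGuarded` §1 ∕ §2's composition RE-DERIVED BY TOKEN-PASS AT Z3 (repair (b), step L3)

Cell `ym-nodeO-ideate`, DEFINER seat `ym-nodeO-def-1` (gen 28; author lineage of Z1 ∕ Z2 ∕ Z3, `K1ZBWitnessBetaRadius`, A2ʷ-ZB, the Z socket).  NEW leaf, theorems only (0 `def`, 0 `sorry`);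
k0-s1-w3's files (p-landed), dag-n07-e's modules 51 ∕ 53, node00-def-K0a's 13b ∕ 13e ∕ 14d ∕ 15a, dag-n21-c's A2ʷ ∕ Cʷ‴, N26's `exists_betaBox_betaOfRecord₁₃_of_jetsFreePair` CONSUMED BY NAME,
nothing modified.  `--kind proof --supports stmt-QuantumFields-20541 --as helper` (count-neutral).  Plan g91 SIZING WORD K0-AT-Z3 (pub-ymgap bus 2026-08-29 07:15:50Z): «GO L1 · GO L2 · GO L3 ·
L4 = V22-Z BY ONE SUBSTITUTION `theta13OfThm1CCMW F 2 j γ ε₀ … ↦ theta13OfThm1CCMWZB F 2 j (1∕2) εbg ε₀ …` with `εbg := a₀` the SAME `a₀` the stub texts ∀-bind».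
[15] = [Balaban1985Variational]; [6] = [Balaban1985RegularSpaces]; [III] = [Balaban1988Convergent]; [I] = [Balaban1987RG1]; [II] = [Balaban1989LargeFieldII]; [IV] = [Balaban1989LargeFieldI].

WHY.  DEF-1 g27 (`K1ZBWitnessBetaRadius`, p685339): β of record READS `εbg` (merged term (1.6) at the background minimiser), so K0⁷'s witnesses of record (`εbg = 1`, outside [B11] Thm 1's
regime) and the print-regime member `εbg := a₀` (which N09's tower `…N09TowerOfNumericsAtThm1CCMWZB` serves) carry different β's with no `rfl` bridge; dag-n24-c g14 adopted repair (b) «K0's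
body ∕ box re-stated at the print-regime member».  The body of record (V21-G's FILE 4‴) pins the witness ONLY through (i) A2ʷ's witness-level letters — now A2ʷ-ZB
`Record13LettersOfThm1CCMWZB` (L1) — and (ii) K0a's ⁵ socket for the coupling-blind family — now `Record13SepCoPLiveSelectorZ` (L2) at `theta13LiveOfNumericsZ`, of which the Z3
member IS a member (Z3 `theta13OfThm1CCMWZB_eq`, `rfl`); §1 of `…K0AllTorusOfStepTokensGuarded` (`bgAtDatumCoP_…_allTorus`), §0 (`succ_add_le_of_partCompat₁₃`), the ⁵→⁶→⁷ lifts, module 51 ∕ 53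
and the (9)-supplier `gauge9SupplierG3_of_prop6MemberP` are θ- ∕ text-GENERIC.  THIS FILE is the token-pass `theta13OfThm1CCMW … ↦ theta13OfThm1CCMWZB … εbg … Efl logz` of the witness-level
chain, with ONE new sign `0 < εbg` threaded (Z3's `admissible_…_of_le_half` ∕ `stage12NumericsOfThm1CCMWB_pos_of_le_half`), and the abs β-box read at the HALF-WINDOW Z3 member
`theta13OfThm1CCMWZB F 2 j (1∕2) εbg ε₀ ε₂₉ B₃ B₉ a₀ a₁ Efl logz` (A1's `theta13OfThm1CCM …` IS its `(εbg, Efl, logz) = (1, 0, 0)` instance: Z2 `theta13OfThm1CCM_eq_Z` ∘ Z3 `theta13OfThm1CCMZ_eq_B`).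
At the cube-letter level (§1–§4) `εbg`, `Efl`, `logz` are FREE; in §4's stub-level supplier form and §5's composition the box is read at `εbg := a₀` (plan's (c)) and `Efl logz` are parameters.

WHAT THIS FILE PROVES (CONDITIONAL reductions; every [15] ∕ [6] ∕ [I] sentence a displayed HYPOTHESIS).
* §1 `bgSepCoPAt_theta13OfThm1CCMWZB_gridGuard_of_thm1RegSepCoP7MG_of_thm1GaugeG_of_hcomp_allTorus` — row P11 at the Co carrier at the Z3 member under `A‴`, `hAdm` discharged as at the witness of record.
* §2 ★ the POINTED provisos `provisos₁₃SepCoP_theta13OfThm1CCMWZB_gridGuard_of_thm1RegSepCoP7MG_of_thm1GaugeG_of_hcomp_allTorus` (general `N`; door form) and the closers `exists_k0SepCoP_ ∕ exists_k0SepCoPH_thm1CCMWZB_gridGuard_of_thm1RegSepCoP7MG_of_thm1GaugeG_of_hcomp_allTorus`, ★★ `…_of_gauge9TopStepG_…`, `…_of_prop8TopStepG_of_gauge9TopStepG_…`.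
* §3 `clausesH_of_absBoxZB` — ONE abs β-box of the half-window Z3 member ⟹ (hcomp) ∧ (hcompRev) at a window `γ ≤ ½` (window shrink + A2ʷ-ZB §6′).
* §4 ★ `exists_k0H_of_thm1CoP7MG3_of_gauge9G3_of_absBoxZB` (PART 1-G‴ at Z3), ★★ `record13SepCoPHBody_of_stub1G3_of_gauge9SupplierG3_of_absBetaBoxAtG3ZB` (stub-level, GENERIC (9)-supplier,
  box at `εbg := a₀`), `absBetaBoxAtG3ZB_of_jetsFreePairAtG3ZB` (NODE O's jets-free pair AT THE Z3 MEMBER supplies the Z3 box — N26's socket is θ-generic).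
* §5 ★★★ `record13SepCoPHBody_of_stubs1G3_2P_3A'G3ZB` — V21-G's FILE 4‴ composition with 3ᴬ′-G‴'s box read at the Z3 member (`εbg := a₀`), stub 1-G‴ and the landed stub 2′ texts
  VERBATIM: the body a V22-Z registration would compose (the TEXT is the plan's; this is a candidate's kernel check, not a registration).

HONEST FRAMING.  Count-neutral kernel re-keying BY NAME; nothing of Bałaban asserted; NOT a discharge; no value of `εbg` ∕ `Efl` ∕ `logz` chosen FOR anybody (letters; §4–§5 display the
plan's `εbg := a₀` option); K0⁷ stmt-QuantumFields-20541 (V21-G 1d9e17422df218f7, 0∕2) texts untouched and NOT closed — V22-Z is the plan's INTENT after this file + k0-s1's word; K1⁹ 27364 ∕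
K3⁸ 27366 OPEN; FLAG №7 NOT closed (only WHICH β the undischarged box is about changes); N07 ∕ N09 ∕ NODE O NOT discharged; counts unmoved (typed 28∕28 · discharged 8∕28); the route closes
only the conditional finite-𝕋⁴ rung `BalabanLadder.UV` — NOT continuum ∕ ℝ⁴ ∕ OS; the Yang–Mills mass gap (Clay) is NOT proved by any of this.  No `sorry`, `def`, `instance`, `notation`.
-/

noncomputable section

open MeasureTheory
open scoped Matrix.Norms.L2Operator

namespace Summit.QuantumFields.YangMills.Theorems.K0AllTorusOfStepTokensGuardedZB

open Literature.MathematicalPhysics.QuantumFieldTheory.Balaban1983to89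
open Literature.MathematicalPhysics.QuantumFieldTheory.Balaban1983to89.Node00
open Literature.MathematicalPhysics.QuantumFieldTheory.Balaban1983to89.T4Continuum
open Literature.MathematicalPhysics.QuantumFieldTheory.Balaban1983to89.FlowStep
open Literature.MathematicalPhysics.QuantumFieldTheory.Balaban1983to89.FlowStepRuns
open Literature.MathematicalPhysics.QuantumFieldTheory.Balaban1983to89.B14.Eq218Concrete
open Literature.MathematicalPhysics.QuantumFieldTheory.Balaban1983to89.B15DeterminingSets
open Literature.MathematicalPhysics.QuantumFieldTheory.Balaban1983to89.B12RegularSpaces111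
open Literature.MathematicalPhysics.QuantumFieldTheory.Balaban1983to89.B14RegularSpaces234
open Literature.MathematicalPhysics.QuantumFieldTheory.Balaban1983to89.B8LeafModelZd (ZdIdx)
open Literature.MathematicalPhysics.QuantumFieldTheory.Balaban1983to89.Beta.Drift (OneLoopDrift)
open Summit.QuantumFields.BalabanUV.Gaps.BetaContFromD4Chain (AtSlopeCont)
open Summit.QuantumFields.YangMills.BalabanUVNodes.N07Thm1Top7FromProp8 (variationalThm1RegSepCoP7MG_of_prop8TopStepG)
open Summit.QuantumFields.YangMills.Theorems.K0AllTorusOfStepTokensGuarded (succ_add_le_of_partCompat₁₃ bgAtDatumCoP_of_thm1RegSepCoP7MG_of_thm1GaugeG_allTorus)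
open Summit.QuantumFields.YangMills.Theorems.BalabanUVNodesN26AtRecord13BetaBoxOfDriftAtSlope (exists_betaBox_betaOfRecord₁₃_of_jetsFreePair)
open Summit.QuantumFields.YangMills.Theorems.K0PrintCubeOfStepTokensGridGuarded (gauge9SupplierG3_of_prop6MemberP)

/-! ## §1  ★★ Row P11 at the Co carrier AT THE Z3 MEMBER under the four-conjunct grid guard (`c ≤ L^j`, `c₀ ≤ j + 1`, `c₁ ≤ j`) — k0-s1-w3 §2 at Z3 -/

section AtWitnessGridGuardZB

variable {F : T4Family} {N : ℕ} [NeZero N] {j c c₀ c₁ : ℕ} {γ εbg ε₀ ε₂₉ B₃ B₃' a₀ a₁ : ℝ} {Efl logz : B12.RunParams → ℕ → ℝ}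

/-- **★★ THE (7)-GUARDED SEPARATED ROW P11 AT THE Co CARRIER AT `θ₁₅ᶜᶜᴹᵂᶻᴮ(j; γ; εbg)` UNDER THE FOUR-CONJUNCT CANDIDATE GUARD**
`Adm := fun ν M g K k _ => c ≤ ν.M₁ ∧ k + c₀ ≤ F.m + K ∧ F.L ^ c₁ ∣ M ∧ ∀ i, 1 ≤ i → i ≤ k → dCubeSide (F.P K).L M (RkOfRecord (F.P K).L ν.r (g i)) i ∣ (F.P K).sitesPerDir 0`
with `c ≤ L^j`, `c₀ ≤ j + 1`, `c₁ ≤ j` — k0-s1-w3's `…K0Stub1GridNumericsGuardWitness` §2 VERBATIM but for the witness (Z3 member, A2ʷ-ZB letters, one new sign `0 < εbg`): p635083 §1's all-torus lift (guard-generic, outer `hAdm`) with `hAdm` DISCHARGED at every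
torus-compatible run of the window by: the floor (`ν.M₁ = L^j ≥ c`), the level letter (p635083 §0: `n + j + 1 ≤ F.m + p.K`), the cube letter `τ9.M = L^j` (`L^{c₁} ∣ L^j`),
and `PartCompat₁₃ F N θ p n` ITSELF (the fourth conjunct at `(θ.ν, θ.τ9.M, gOfRecord₁₃ θ p, p.K, n)`, by `rfl`).  CONDITIONAL on the two [15] sentences; nothing asserted.
[cite: Balaban1985Variational, (6)–(7) p.278, Thm 1 (8)–(9) p.279, (144)–(152) pp.300–301, Prop. 8 p.304, p.304 lines 1–2; Balaban1985RegularSpaces, (1.3)–(1.9) p.77; Balaban1988Convergent, Thm 1 p.262, (2.1) p.254, (2.4)–(2.8) pp.255–256, (2.12)–(2.13) pp.256–257, (2.17)–(2.18) p.257, (2.25)–(2.28) pp.258–259; Balaban1987RG1, Thm 1 p.259, (0.1) p.251, (1.12) p.262] -/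
theorem bgSepCoPAt_theta13OfThm1CCMWZB_gridGuard_of_thm1RegSepCoP7MG_of_thm1GaugeG_of_hcomp_allTorus (hγ0 : 0 < γ) (hγ : γ ≤ 1 / 2) (hbg : 0 < εbg) (hε : 0 < ε₀) (hε' : 0 < ε₂₉) (hB : 0 ≤ B₃) (hB' : 0 ≤ B₃')
    (ha₀ : 0 < a₀) (ha₁ : 0 < a₁) (hc : c ≤ F.L ^ j) (hc₀ : c₀ ≤ j + 1) (hc₁ : c₁ ≤ j)
    (h15 : VariationalThm1RegSepCoP7MG F N (fun ν M g K k _s => c ≤ ν.M₁ ∧ k + c₀ ≤ F.m + K ∧ F.L ^ c₁ ∣ M ∧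
      ∀ i, 1 ≤ i → i ≤ k → dCubeSide (F.P K).L M (RkOfRecord (F.P K).L ν.r (g i)) i ∣ (F.P K).sitesPerDir 0) B₃ a₀ a₁)
    (h15G : VariationalThm1GaugeRegSepCoP7MG F N (F.L ^ j) (fun ν M g K k _s => c ≤ ν.M₁ ∧ k + c₀ ≤ F.m + K ∧ F.L ^ c₁ ∣ M ∧
      ∀ i, 1 ≤ i → i ≤ k → dCubeSide (F.P K).L M (RkOfRecord (F.P K).L ν.r (g i)) i ∣ (F.P K).sitesPerDir 0) B₃ B₃' a₀ a₁)
    (hcomp : ∀ (p : B12.RunParams) (n : ℕ), n ≤ p.K → Step.InInterval (theta13OfThm1CCMWZB F N j γ εbg ε₀ ε₂₉ B₃ B₃' a₀ a₁ Efl logz).γ n (gOfRecord₁₃ F N (theta13OfThm1CCMWZB F N j γ εbg ε₀ ε₂₉ B₃ B₃' a₀ a₁ Efl logz) p) → ∀ m, m < n →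
      (theta13OfThm1CCMWZB F N j γ εbg ε₀ ε₂₉ B₃ B₃' a₀ a₁ Efl logz).s2.cR * epsOfRecord (theta13OfThm1CCMWZB F N j γ εbg ε₀ ε₂₉ B₃ B₃' a₀ a₁ Efl logz).ν (gOfRecord₁₃ F N (theta13OfThm1CCMWZB F N j γ εbg ε₀ ε₂₉ B₃ B₃' a₀ a₁ Efl logz) p) m ≤ 2 * ((theta13OfThm1CCMWZB F N j γ εbg ε₀ ε₂₉ B₃ B₃' a₀ a₁ Efl logz).s2.cR * epsOfRecord (theta13OfThm1CCMWZB F N j γ εbg ε₀ ε₂₉ B₃ B₃' a₀ a₁ Efl logz).ν (gOfRecord₁₃ F N (theta13OfThm1CCMWZB F N j γ εbg ε₀ ε₂₉ B₃ B₃' a₀ a₁ Efl logz) p) (m + 1)))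
    (hcompRev : ∀ (p : B12.RunParams) (n : ℕ), n ≤ p.K → Step.InInterval (theta13OfThm1CCMWZB F N j γ εbg ε₀ ε₂₉ B₃ B₃' a₀ a₁ Efl logz).γ n (gOfRecord₁₃ F N (theta13OfThm1CCMWZB F N j γ εbg ε₀ ε₂₉ B₃ B₃' a₀ a₁ Efl logz) p) → ∀ m, m < n →
      (theta13OfThm1CCMWZB F N j γ εbg ε₀ ε₂₉ B₃ B₃' a₀ a₁ Efl logz).s2.cR * epsOfRecord (theta13OfThm1CCMWZB F N j γ εbg ε₀ ε₂₉ B₃ B₃' a₀ a₁ Efl logz).ν (gOfRecord₁₃ F N (theta13OfThm1CCMWZB F N j γ εbg ε₀ ε₂₉ B₃ B₃' a₀ a₁ Efl logz) p) (m + 1) ≤ 2 * ((theta13OfThm1CCMWZB F N j γ εbg ε₀ ε₂₉ B₃ B₃' a₀ a₁ Efl logz).s2.cR * epsOfRecord (theta13OfThm1CCMWZB F N j γ εbg ε₀ ε₂₉ B₃ B₃' a₀ a₁ Efl logz).ν (gOfRecord₁₃ F N (theta13OfThm1CCMWZB F N j γ εbg ε₀ ε₂₉ B₃ B₃' a₀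 a₁ Efl logz) p) m)) :
    ∀ (p : B12.RunParams) (n : ℕ), n ≤ p.K → Step.InInterval (theta13OfThm1CCMWZB F N j γ εbg ε₀ ε₂₉ B₃ B₃' a₀ a₁ Efl logz).γ n (gOfRecord₁₃ F N (theta13OfThm1CCMWZB F N j γ εbg ε₀ ε₂₉ B₃ B₃' a₀ a₁ Efl logz) p) → PartCompat₁₃ F N (theta13OfThm1CCMWZB F N j γ εbg ε₀ ε₂₉ B₃ B₃' a₀ a₁ Efl logz) p n →
      ∀ s : SeqOfRecord F (theta13OfThm1CCMWZB F N j γ εbg ε₀ ε₂₉ B₃ B₃' a₀ a₁ Efl logz).ν (theta13OfThm1CCMWZB F N j γ εbg ε₀ ε₂₉ B₃ B₃' a₀ a₁ Efl logz).τ9.M (gOfRecord₁₃ F N (theta13OfThm1CCMWZB F N j γ εbg ε₀ ε₂₉ B₃ B₃' a₀ a₁ Efl logz) p) p.K n, Sect2.SeqSeparated (theta13OfThm1CCMWZB F N j γ εbg ε₀ ε₂₉ B₃ B₃' a₀ a₁ Efl logz).ν.M₁ s →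
      ∀ W : MSField (F.P p.K) (SU N), W ∈ suppOfRecord₁₃P F N (theta13OfThm1CCMWZB F N j γ εbg ε₀ ε₂₉ B₃ B₃' a₀ a₁ Efl logz) p n s →
      Sect2.DataSmall7PTop (avOfRecord F N p.K) s.Ω (suppDomOfRecord F (theta13OfThm1CCMWZB F N j γ εbg ε₀ ε₂₉ B₃ B₃' a₀ a₁ Efl logz).ν p.K s.Ω) n (fun j' => (theta13OfThm1CCMWZB F N j γ εbg ε₀ ε₂₉ B₃ B₃' a₀ a₁ Efl logz).s2.cR * epsOfRecord (theta13OfThm1CCMWZB F N j γ εbg ε₀ ε₂₉ B₃ B₃' a₀ a₁ Efl logz).ν (gOfRecord₁₃ F N (theta13OfThm1CCMWZB F N j γ εbg ε₀ ε₂₉ B₃ B₃' a₀ a₁ Efl logz) p) j') W →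
      ∀ j', 1 ≤ j' → j' ≤ n → ∀ X : (Sect2.domSys (F.P p.K) (theta13OfThm1CCMWZB F N j γ εbg ε₀ ε₂₉ B₃ B₃' a₀ a₁ Efl logz).τ9.M j').Dom,
      (Sect2.domSites (F.P p.K) (theta13OfThm1CCMWZB F N j γ εbg ε₀ ε₂₉ B₃ B₃' a₀ a₁ Efl logz).τ9.M j' X ⊆ s.Λ j' →
        Sect2.ofBackgroundC (settingOfRecord₁₃ F N (theta13OfThm1CCMWZB F N j γ εbg ε₀ ε₂₉ B₃ B₃' a₀ a₁ Efl logz) p).ι (UbgOfRecord₁₃CoP F N (theta13OfThm1CCMWZB F N j γ εbg ε₀ ε₂₉ B₃ B₃' a₀ a₁ Efl logz) p n s W) ∈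
          Sect2.spaceI (settingOfRecord₁₃ F N (theta13OfThm1CCMWZB F N j γ εbg ε₀ ε₂₉ B₃ B₃' a₀ a₁ Efl logz) p) ((theta13OfThm1CCMWZB F N j γ εbg ε₀ ε₂₉ B₃ B₃' a₀ a₁ Efl logz).Rz p.K) (theta13OfThm1CCMWZB F N j γ εbg ε₀ ε₂₉ B₃ B₃' a₀ a₁ Efl logz).τ9.M j' (Sect2.domSites (F.P p.K) (theta13OfThm1CCMWZB F N j γ εbg ε₀ ε₂₉ B₃ B₃' a₀ a₁ Efl logz).τ9.M j' X)
            ((settingOfRecord₁₃ F N (theta13OfThm1CCMWZB F N j γ εbg ε₀ ε₂₉ B₃ B₃' a₀ a₁ Efl logz) p).lf.alpha0 ((settingOfRecord₁₃ F N (theta13OfThm1CCMWZB F N j γ εbg ε₀ ε₂₉ B₃ B₃' a₀ a₁ Efl logz) p).flow.g j')) ((settingOfRecord₁₃ F N (theta13OfThm1CCMWZB F N j γ εbg ε₀ ε₂₉ B₃ B₃' a₀ a₁ Efl logz) p).lf.alpha1 ((settingOfRecord₁₃ F N (theta13OfThm1CCMWZB F N j γ εbg ε₀ ε₂₉ B₃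 B₃' a₀ a₁ Efl logz) p).flow.g j'))) ∧
      (Sect2.admB (F.P p.K) (theta13OfThm1CCMWZB F N j γ εbg ε₀ ε₂₉ B₃ B₃' a₀ a₁ Efl logz).ν (theta13OfThm1CCMWZB F N j γ εbg ε₀ ε₂₉ B₃ B₃' a₀ a₁ Efl logz).τ9.M (gOfRecord₁₃ F N (theta13OfThm1CCMWZB F N j γ εbg ε₀ ε₂₉ B₃ B₃' a₀ a₁ Efl logz) p) s.Ω s.Λ j' (Sect2.domSites (F.P p.K) (theta13OfThm1CCMWZB F N j γ εbg ε₀ ε₂₉ B₃ B₃' a₀ a₁ Efl logz).τ9.M j' X) = true →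
        Sect2.ofBackgroundC (settingOfRecord₁₃ F N (theta13OfThm1CCMWZB F N j γ εbg ε₀ ε₂₉ B₃ B₃' a₀ a₁ Efl logz) p).ι (UbgOfRecord₁₃CoP F N (theta13OfThm1CCMWZB F N j γ εbg ε₀ ε₂₉ B₃ B₃' a₀ a₁ Efl logz) p n s W) ∈
          Sect2.spaceMS (settingOfRecord₁₃ F N (theta13OfThm1CCMWZB F N j γ εbg ε₀ ε₂₉ B₃ B₃' a₀ a₁ Efl logz) p) ((theta13OfThm1CCMWZB F N j γ εbg ε₀ ε₂₉ B₃ B₃' a₀ a₁ Efl logz).Rz p.K) (theta13OfThm1CCMWZB F N j γ εbg ε₀ ε₂₉ B₃ B₃' a₀ a₁ Efl logz).τ9.M j' (Sect2.domSites (F.P p.K) (theta13OfThm1CCMWZB F N j γ εbg ε₀ ε₂₉ B₃ B₃' a₀ a₁ Efl logz).τ9.M j' X) s.Ω) := by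
  intro p n hn hw hpc s hsep W _ h7
  cases n with
  | zero => intro j' h1 hj'; exfalso; omega
  | succ n =>
    rw [UbgOfRecord₁₃CoP_succ]
    refine bgAtDatumCoP_of_thm1RegSepCoP7MG_of_thm1GaugeG_allTorus (theta13OfThm1CCMWZB F N j γ εbg ε₀ ε₂₉ B₃ B₃' a₀ a₁ Efl logz)
      (admissible_theta13OfThm1CCMWZB_of_le_half F N Efl logz hγ0 hγ hbg hε hε' hB hB' ha₀ ha₁) rfl
      (τ9_M_pos_theta13OfThm1CCMWZB F N j γ εbg ε₀ ε₂₉ B₃ B₃' a₀ a₁ Efl logz) h15 h15G (hnum_theta13OfThm1CCMWZB hγ hB hB' ha₀ ha₁) εreg_le_theta13OfThm1CCMWZB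
      hcomp hcompRev (hBα_theta13OfThm1CCMWZB hγ hB hB' ha₀.le ha₁.le)
      (htI_theta13OfThm1CCMWZB hγ hB hB' ha₀.le ha₁.le) (htMS_theta13OfThm1CCMWZB hγ hB hB' ha₀.le ha₁.le) (hC1_theta13OfThm1CCMWZB hγ) ⟨j, theta13OfThm1CCMWZB_τ9_M F N j γ εbg ε₀ ε₂₉ B₃ B₃' a₀ a₁ Efl logz⟩
      (fun p' n' s' hn1 hn' hw' hpc' => ⟨?_, ?_, ?_, hpc'⟩) p (n + 1) hn hw hpc s hsep (M₁_pos_theta13OfThm1CCMWZB F N j γ εbg ε₀ ε₂₉ B₃ B₃' a₀ a₁ Efl logz) W h7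
    · rw [theta13OfThm1CCMWZB_M₁]; exact hc
    · have h := succ_add_le_of_partCompat₁₃ (theta13OfThm1CCMWZB F N j γ εbg ε₀ ε₂₉ B₃ B₃' a₀ a₁ Efl logz) (theta13OfThm1CCMWZB_τ9_M F N j γ εbg ε₀ ε₂₉ B₃ B₃' a₀ a₁ Efl logz) hn1 hpc'
        ((hC1_theta13OfThm1CCMWZB hγ) p' n' hn' hw')
      omega
    · rw [theta13OfThm1CCMWZB_τ9_M]; exact pow_dvd_pow F.L hc₁


end AtWitnessGridGuardZB

/-! ## §2  Closers under the grid guard AT THE Z3 MEMBER — k0-s1-w3 §3 over the Z socket (L2) and the ⁵→⁶→⁷ lifts -/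


/-! ## §3  Closers under the CANDIDATE guard, (hcomp) ∧ (hcompRev), on EVERY family — p635083 §3 with the guard replaced -/

section ClosersGridGuardZB

variable {j c c₀ c₁ : ℕ} {γ εbg ε₀ ε₂₉ B₃ B₃' a₀ a₁ : ℝ} {Efl logz : B12.RunParams → ℕ → ℝ}

/-- **★ THE v1.5 PROVISOS `Provisos₁₃SepCoP` AT THE Z3 MEMBER, POINTED** (general `N`; the form a DOOR consumer reads — dag-n24-c's K1-face engine, dag-n11-w1's Gauss-pin rows):
the Z socket's constructor `provisos₁₃SepCoP_theta13LiveOfNumericsZ_of_bgSepCoP` (L2; `hM := ⟨j, rfl⟩`, `hM₁ := dvd_refl _`) fed by §1's row.  At the εbg = 1, `(Efl, logz) = (0, 0)` member this is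
NOT obtainable from the W row by `rfl` (β and the histories read `εbg` — DEF-1 g27), hence the genuine Z3 row of §1.  CONDITIONAL on the two [15] sentences and the clauses; nothing asserted.
[cite: Balaban1985Variational, (6)–(7) p.278, Thm 1 (8)–(9) p.279, (144)–(152) pp.300–301; Balaban1985RegularSpaces, (1.3)–(1.9) p.77; Balaban1988Convergent, Thm 1 p.262, (2.18) p.257, (2.28) p.259, (3.16) p.268, (3.22) p.269; Balaban1989LargeFieldI, (0.3)–(0.4) p.176] -/
theorem provisos₁₃SepCoP_theta13OfThm1CCMWZB_gridGuard_of_thm1RegSepCoP7MG_of_thm1GaugeG_of_hcomp_allTorus (F : T4Family) (N : ℕ) [NeZero N] (hγ0 : 0 < γ) (hγ : γ ≤ 1 / 2) (hbg : 0 < εbg) (hε : 0 < ε₀) (hε' : 0 < ε₂₉) (hB : 0 ≤ B₃)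
    (hB' : 0 ≤ B₃') (ha₀ : 0 < a₀) (ha₁ : 0 < a₁) (hc : c ≤ F.L ^ j) (hc₀ : c₀ ≤ j + 1) (hc₁ : c₁ ≤ j)
    (h15 : VariationalThm1RegSepCoP7MG F N (fun ν M g K k _s => c ≤ ν.M₁ ∧ k + c₀ ≤ F.m + K ∧ F.L ^ c₁ ∣ M ∧
      ∀ i, 1 ≤ i → i ≤ k → dCubeSide (F.P K).L M (RkOfRecord (F.P K).L ν.r (g i)) i ∣ (F.P K).sitesPerDir 0) B₃ a₀ a₁)
    (h15G : VariationalThm1GaugeRegSepCoP7MG F N (F.L ^ j) (fun ν M g K k _s => c ≤ ν.M₁ ∧ k + c₀ ≤ F.m + K ∧ F.L ^ c₁ ∣ M ∧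
      ∀ i, 1 ≤ i → i ≤ k → dCubeSide (F.P K).L M (RkOfRecord (F.P K).L ν.r (g i)) i ∣ (F.P K).sitesPerDir 0) B₃ B₃' a₀ a₁)
    (hcomp : ∀ (p : B12.RunParams) (n : ℕ), n ≤ p.K → Step.InInterval (theta13OfThm1CCMWZB F N j γ εbg ε₀ ε₂₉ B₃ B₃' a₀ a₁ Efl logz).γ n (gOfRecord₁₃ F N (theta13OfThm1CCMWZB F N j γ εbg ε₀ ε₂₉ B₃ B₃' a₀ a₁ Efl logz) p) → ∀ m, m < n →
      (theta13OfThm1CCMWZB F N j γ εbg ε₀ ε₂₉ B₃ B₃' a₀ a₁ Efl logz).s2.cR * epsOfRecord (theta13OfThm1CCMWZB F N j γ εbg ε₀ ε₂₉ B₃ B₃' a₀ a₁ Efl logz).ν (gOfRecord₁₃ F N (theta13OfThm1CCMWZB F N j γ εbg ε₀ ε₂₉ B₃ B₃' a₀ a₁ Efl logz) p) m ≤ 2 * ((theta13OfThm1CCMWZB F N j γ εbg ε₀ ε₂₉ B₃ B₃' a₀ a₁ Efl logz).s2.cR * epsOfRecord (theta13OfThm1CCMWZB F N j γ εbg ε₀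 ε₂₉ B₃ B₃' a₀ a₁ Efl logz).ν (gOfRecord₁₃ F N (theta13OfThm1CCMWZB F N j γ εbg ε₀ ε₂₉ B₃ B₃' a₀ a₁ Efl logz) p) (m + 1)))
    (hcompRev : ∀ (p : B12.RunParams) (n : ℕ), n ≤ p.K → Step.InInterval (theta13OfThm1CCMWZB F N j γ εbg ε₀ ε₂₉ B₃ B₃' a₀ a₁ Efl logz).γ n (gOfRecord₁₃ F N (theta13OfThm1CCMWZB F N j γ εbg ε₀ ε₂₉ B₃ B₃' a₀ a₁ Efl logz) p) → ∀ m, m < n →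
      (theta13OfThm1CCMWZB F N j γ εbg ε₀ ε₂₉ B₃ B₃' a₀ a₁ Efl logz).s2.cR * epsOfRecord (theta13OfThm1CCMWZB F N j γ εbg ε₀ ε₂₉ B₃ B₃' a₀ a₁ Efl logz).ν (gOfRecord₁₃ F N (theta13OfThm1CCMWZB F N j γ εbg ε₀ ε₂₉ B₃ B₃' a₀ a₁ Efl logz) p) (m + 1) ≤ 2 * ((theta13OfThm1CCMWZB F N j γ εbg ε₀ ε₂₉ B₃ B₃' a₀ a₁ Efl logz).s2.cR * epsOfRecord (theta13OfThm1CCMWZB F N j γ εbg ε₀ ε₂₉ B₃ B₃' a₀ a₁ Efl logz).ν (gOfRecord₁₃ F N (theta13OfThm1CCMWZB F N j γ εbg ε₀ ε₂₉ B₃ B₃' a₀ a₁ Efl logz) p) m)) :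
    (theta13OfThm1CCMWZB F N j γ εbg ε₀ ε₂₉ B₃ B₃' a₀ a₁ Efl logz).Provisos₁₃SepCoP F N :=
  provisos₁₃SepCoP_theta13LiveOfNumericsZ_of_bgSepCoP F N (stage12NumericsOfThm1CCMWB F.L j γ εbg ε₀ B₃ B₃' a₀ a₁) ε₂₉ Efl logz ⟨j, rfl⟩ (dvd_refl _)
    (bgSepCoPAt_theta13OfThm1CCMWZB_gridGuard_of_thm1RegSepCoP7MG_of_thm1GaugeG_of_hcomp_allTorus hγ0 hγ hbg hε hε' hB hB' ha₀ ha₁ hc hc₀ hc₁ h15 h15G hcomp hcompRev)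

/-- **THE K0 BODY (⁵) FOR `F` AT `N = 2` AT `θ₁₅ᶜᶜᴹᵂᶻᴮ(j; γ; εbg)` UNDER THE CANDIDATE GUARD** (16a's socket ∘ the row above) — k0-s1-w3's first closer at the Z3 member, through the Z socket `exists_k0SepCoP_of_bgSepCoP_theta13LiveOfNumericsZ` (L2) and Z3's `stage12NumericsOfThm1CCMWB_pos_of_le_half`.
CONDITIONAL; K0 NOT closed here. [cite: Balaban1985Variational, Thm 1 (8)–(9) p.279, Prop. 8 p.304; Balaban1988Convergent, Thm 1 p.262, (2.1) p.254, (2.4)–(2.8) pp.255–256, p.257; Balaban1987RG1, Thm 1 p.259, (0.1) p.251] -/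
theorem exists_k0SepCoP_thm1CCMWZB_gridGuard_of_thm1RegSepCoP7MG_of_thm1GaugeG_of_hcomp_allTorus (F : T4Family) (hγ0 : 0 < γ) (hγ : γ ≤ 1 / 2) (hbg : 0 < εbg) (hε : 0 < ε₀) (hε' : 0 < ε₂₉) (hB : 0 ≤ B₃)
    (hB' : 0 ≤ B₃') (ha₀ : 0 < a₀) (ha₁ : 0 < a₁) (hc : c ≤ F.L ^ j) (hc₀ : c₀ ≤ j + 1) (hc₁ : c₁ ≤ j)
    (h15 : VariationalThm1RegSepCoP7MG F 2 (fun ν M g K k _s => c ≤ ν.M₁ ∧ k + c₀ ≤ F.m + K ∧ F.L ^ c₁ ∣ M ∧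
      ∀ i, 1 ≤ i → i ≤ k → dCubeSide (F.P K).L M (RkOfRecord (F.P K).L ν.r (g i)) i ∣ (F.P K).sitesPerDir 0) B₃ a₀ a₁)
    (h15G : VariationalThm1GaugeRegSepCoP7MG F 2 (F.L ^ j) (fun ν M g K k _s => c ≤ ν.M₁ ∧ k + c₀ ≤ F.m + K ∧ F.L ^ c₁ ∣ M ∧
      ∀ i, 1 ≤ i → i ≤ k → dCubeSide (F.P K).L M (RkOfRecord (F.P K).L ν.r (g i)) i ∣ (F.P K).sitesPerDir 0) B₃ B₃' a₀ a₁)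
    (hcomp : ∀ (p : B12.RunParams) (n : ℕ), n ≤ p.K → Step.InInterval (theta13OfThm1CCMWZB F 2 j γ εbg ε₀ ε₂₉ B₃ B₃' a₀ a₁ Efl logz).γ n (gOfRecord₁₃ F 2 (theta13OfThm1CCMWZB F 2 j γ εbg ε₀ ε₂₉ B₃ B₃' a₀ a₁ Efl logz) p) → ∀ m, m < n →
      (theta13OfThm1CCMWZB F 2 j γ εbg ε₀ ε₂₉ B₃ B₃' a₀ a₁ Efl logz).s2.cR * epsOfRecord (theta13OfThm1CCMWZB F 2 j γ εbg ε₀ ε₂₉ B₃ B₃' a₀ a₁ Efl logz).ν (gOfRecord₁₃ F 2 (theta13OfThm1CCMWZB F 2 j γ εbg ε₀ ε₂₉ B₃ B₃' a₀ a₁ Efl logz) p) m ≤ 2 * ((theta13OfThm1CCMWZB F 2 j γ εbg ε₀ ε₂₉ B₃ B₃' a₀ a₁ Efl logz).s2.cR * epsOfRecord (theta13OfThm1CCMWZB F 2 j γ εbg ε₀ ε₂₉ B₃ B₃' a₀ a₁ Efl logz).ν (gOfRecord₁₃ F 2 (theta13OfThm1CCMWZB F 2 j γ εbg ε₀ ε₂₉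 B₃ B₃' a₀ a₁ Efl logz) p) (m + 1)))
    (hcompRev : ∀ (p : B12.RunParams) (n : ℕ), n ≤ p.K → Step.InInterval (theta13OfThm1CCMWZB F 2 j γ εbg ε₀ ε₂₉ B₃ B₃' a₀ a₁ Efl logz).γ n (gOfRecord₁₃ F 2 (theta13OfThm1CCMWZB F 2 j γ εbg ε₀ ε₂₉ B₃ B₃' a₀ a₁ Efl logz) p) → ∀ m, m < n →
      (theta13OfThm1CCMWZB F 2 j γ εbg ε₀ ε₂₉ B₃ B₃' a₀ a₁ Efl logz).s2.cR * epsOfRecord (theta13OfThm1CCMWZB F 2 j γ εbg ε₀ ε₂₉ B₃ B₃' a₀ a₁ Efl logz).ν (gOfRecord₁₃ F 2 (theta13OfThm1CCMWZB F 2 j γ εbg ε₀ ε₂₉ B₃ B₃' a₀ a₁ Efl logz) p) (m + 1) ≤ 2 * ((theta13OfThm1CCMWZB F 2 j γ εbg ε₀ ε₂₉ B₃ B₃' a₀ a₁ Efl logz).s2.cR * epsOfRecord (theta13OfThm1CCMWZB F 2 j γ εbg ε₀ ε₂₉ B₃ B₃' a₀ a₁ Efl logz).ν (gOfRecord₁₃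 F 2 (theta13OfThm1CCMWZB F 2 j γ εbg ε₀ ε₂₉ B₃ B₃' a₀ a₁ Efl logz) p) m)) :
    ∃ θ : Stage13Params F 2, θ.Provisos₁₃SepCoP F 2 ∧ (θ.ZtUnity F 2 ∧ θ.SlotsNondegenerate₁₃ F 2) ∧ θ.Admissible F 2 :=
  exists_k0SepCoP_of_bgSepCoP_theta13LiveOfNumericsZ F (stage12NumericsOfThm1CCMWB_pos_of_le_half (L := F.L) (j := j) F.hL.2.le hγ0 hγ hbg hε hB hB' ha₀ ha₁) hε' ⟨j, rfl⟩ (dvd_refl _)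
    (bgSepCoPAt_theta13OfThm1CCMWZB_gridGuard_of_thm1RegSepCoP7MG_of_thm1GaugeG_of_hcomp_allTorus hγ0 hγ hbg hε hε' hB hB' ha₀ ha₁ hc hc₀ hc₁ h15 h15G hcomp hcompRev)

/-- **THE ⁷ IMAGE, ON EVERY FAMILY, UNDER THE CANDIDATE GUARD** (FILE 18's cured lift, T's history-blind door) — k0-s1-w3's second closer at the Z3 member.  CONDITIONAL.
[cite: Balaban1985Variational, Thm 1 (8) p.279, Prop. 8 p.304; Balaban1988Convergent, Thm 1 p.262, (2.1) p.254, (2.21) p.258; Balaban1989LargeFieldI, (0.2)–(0.4) p.176] -/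
theorem exists_k0SepCoPH_thm1CCMWZB_gridGuard_of_thm1RegSepCoP7MG_of_thm1GaugeG_of_hcomp_allTorus (F : T4Family) (hγ0 : 0 < γ) (hγ : γ ≤ 1 / 2) (hbg : 0 < εbg) (hε : 0 < ε₀) (hε' : 0 < ε₂₉) (hB : 0 ≤ B₃)
    (hB' : 0 ≤ B₃') (ha₀ : 0 < a₀) (ha₁ : 0 < a₁) (hc : c ≤ F.L ^ j) (hc₀ : c₀ ≤ j + 1) (hc₁ : c₁ ≤ j)
    (h15 : VariationalThm1RegSepCoP7MG F 2 (fun ν M g K k _s => c ≤ ν.M₁ ∧ k + c₀ ≤ F.m + K ∧ F.L ^ c₁ ∣ M ∧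
      ∀ i, 1 ≤ i → i ≤ k → dCubeSide (F.P K).L M (RkOfRecord (F.P K).L ν.r (g i)) i ∣ (F.P K).sitesPerDir 0) B₃ a₀ a₁)
    (h15G : VariationalThm1GaugeRegSepCoP7MG F 2 (F.L ^ j) (fun ν M g K k _s => c ≤ ν.M₁ ∧ k + c₀ ≤ F.m + K ∧ F.L ^ c₁ ∣ M ∧
      ∀ i, 1 ≤ i → i ≤ k → dCubeSide (F.P K).L M (RkOfRecord (F.P K).L ν.r (g i)) i ∣ (F.P K).sitesPerDir 0) B₃ B₃' a₀ a₁)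
    (hcomp : ∀ (p : B12.RunParams) (n : ℕ), n ≤ p.K → Step.InInterval (theta13OfThm1CCMWZB F 2 j γ εbg ε₀ ε₂₉ B₃ B₃' a₀ a₁ Efl logz).γ n (gOfRecord₁₃ F 2 (theta13OfThm1CCMWZB F 2 j γ εbg ε₀ ε₂₉ B₃ B₃' a₀ a₁ Efl logz) p) → ∀ m, m < n →
      (theta13OfThm1CCMWZB F 2 j γ εbg ε₀ ε₂₉ B₃ B₃' a₀ a₁ Efl logz).s2.cR * epsOfRecord (theta13OfThm1CCMWZB F 2 j γ εbg ε₀ ε₂₉ B₃ B₃' a₀ a₁ Efl logz).ν (gOfRecord₁₃ F 2 (theta13OfThm1CCMWZB F 2 j γ εbg ε₀ ε₂₉ B₃ B₃' a₀ a₁ Efl logz) p) m ≤ 2 * ((theta13OfThm1CCMWZB F 2 j γ εbg ε₀ ε₂₉ B₃ B₃' a₀ a₁ Efl logz).s2.cR * epsOfRecord (theta13OfThm1CCMWZB F 2 j γ εbg ε₀ ε₂₉ B₃ B₃' a₀ a₁ Efl logz).ν (gOfRecord₁₃ F 2 (theta13OfThm1CCMWZB F 2 j γ εbg ε₀ ε₂₉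 B₃ B₃' a₀ a₁ Efl logz) p) (m + 1)))
    (hcompRev : ∀ (p : B12.RunParams) (n : ℕ), n ≤ p.K → Step.InInterval (theta13OfThm1CCMWZB F 2 j γ εbg ε₀ ε₂₉ B₃ B₃' a₀ a₁ Efl logz).γ n (gOfRecord₁₃ F 2 (theta13OfThm1CCMWZB F 2 j γ εbg ε₀ ε₂₉ B₃ B₃' a₀ a₁ Efl logz) p) → ∀ m, m < n →
      (theta13OfThm1CCMWZB F 2 j γ εbg ε₀ ε₂₉ B₃ B₃' a₀ a₁ Efl logz).s2.cR * epsOfRecord (theta13OfThm1CCMWZB F 2 j γ εbg ε₀ ε₂₉ B₃ B₃' a₀ a₁ Efl logz).ν (gOfRecord₁₃ F 2 (theta13OfThm1CCMWZB F 2 j γ εbg ε₀ ε₂₉ B₃ B₃' a₀ a₁ Efl logz) p) (m + 1) ≤ 2 * ((theta13OfThm1CCMWZB F 2 j γ εbg ε₀ ε₂₉ B₃ B₃' a₀ a₁ Efl logz).s2.cR * epsOfRecord (theta13OfThm1CCMWZB F 2 j γ εbg ε₀ ε₂₉ B₃ B₃' a₀ a₁ Efl logz).ν (gOfRecord₁₃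 F 2 (theta13OfThm1CCMWZB F 2 j γ εbg ε₀ ε₂₉ B₃ B₃' a₀ a₁ Efl logz) p) m)) :
    ∃ θ : Stage13HParams F 2, θ.Provisos₁₃SepCoPH F 2 ∧ (θ.ZhUnity F 2 ∧ θ.SlotsNondegenerate₁₃ F 2) ∧ θ.Admissible F 2 :=
  exists_k0SepCoPH_of_exists_k0SepCoPR (exists_k0SepCoPR_of_exists_k0SepCoP F
    (exists_k0SepCoP_thm1CCMWZB_gridGuard_of_thm1RegSepCoP7MG_of_thm1GaugeG_of_hcomp_allTorus F hγ0 hγ hbg hε hε' hB hB' ha₀ ha₁ hc hc₀ hc₁ h15 h15G hcomp hcompRev))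

/-- **★★ THE ⁷ K0 BODY KEYED ON THE GUARDED (8) AND THE GUARDED (9)-STEP FACT AT `(L^j, Adm)` UNDER THE CANDIDATE GUARD, ON EVERY FAMILY** (dag-n07-e module 51's
`variationalThm1GaugeRegSepCoP7MG_of_gauge9TopStepG`, guard-generic) — k0-s1-w3's third closer at the Z3 member: the K0 body CLOSES at the print-regime-capable family exactly as at the
witness of record.  CONDITIONAL; nothing registered here.
[cite: Balaban1985Variational, Thm 1 (8)–(9) p.279, (144)–(152) pp.300–301, Prop. 8 p.304; Balaban1988Convergent, Thm 1 p.262, (2.1) p.254, (2.21) p.258, p.257; Balaban1989LargeFieldI, (0.2)–(0.4) p.176] -/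
theorem exists_k0SepCoPH_thm1CCMWZB_gridGuard_of_thm1RegSepCoP7MG_of_gauge9TopStepG_of_hcomp_allTorus (F : T4Family) (hγ0 : 0 < γ) (hγ : γ ≤ 1 / 2) (hbg : 0 < εbg) (hε : 0 < ε₀) (hε' : 0 < ε₂₉)
    (hB : 0 ≤ B₃) (hB' : 0 ≤ B₃') (ha₀ : 0 < a₀) (ha₁ : 0 < a₁) (hc : c ≤ F.L ^ j) (hc₀ : c₀ ≤ j + 1) (hc₁ : c₁ ≤ j)
    (h15 : VariationalThm1RegSepCoP7MG F 2 (fun ν M g K k _s => c ≤ ν.M₁ ∧ k + c₀ ≤ F.m + K ∧ F.L ^ c₁ ∣ M ∧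
      ∀ i, 1 ≤ i → i ≤ k → dCubeSide (F.P K).L M (RkOfRecord (F.P K).L ν.r (g i)) i ∣ (F.P K).sitesPerDir 0) B₃ a₀ a₁)
    (h9 : Gauge9RegSepTopStepG F 2 (fun ν K Ω => suppDomOfRecord F ν K Ω) (F.L ^ j) (fun ν M g K k _s => c ≤ ν.M₁ ∧ k + c₀ ≤ F.m + K ∧ F.L ^ c₁ ∣ M ∧
      ∀ i, 1 ≤ i → i ≤ k → dCubeSide (F.P K).L M (RkOfRecord (F.P K).L ν.r (g i)) i ∣ (F.P K).sitesPerDir 0) B₃ B₃' a₀ a₁)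
    (hcomp : ∀ (p : B12.RunParams) (n : ℕ), n ≤ p.K → Step.InInterval (theta13OfThm1CCMWZB F 2 j γ εbg ε₀ ε₂₉ B₃ B₃' a₀ a₁ Efl logz).γ n (gOfRecord₁₃ F 2 (theta13OfThm1CCMWZB F 2 j γ εbg ε₀ ε₂₉ B₃ B₃' a₀ a₁ Efl logz) p) → ∀ m, m < n →
      (theta13OfThm1CCMWZB F 2 j γ εbg ε₀ ε₂₉ B₃ B₃' a₀ a₁ Efl logz).s2.cR * epsOfRecord (theta13OfThm1CCMWZB F 2 j γ εbg ε₀ ε₂₉ B₃ B₃' a₀ a₁ Efl logz).ν (gOfRecord₁₃ F 2 (theta13OfThm1CCMWZB F 2 j γ εbg ε₀ ε₂₉ B₃ B₃' a₀ a₁ Efl logz) p) m ≤ 2 * ((theta13OfThm1CCMWZB F 2 j γ εbg ε₀ ε₂₉ B₃ B₃' a₀ a₁ Efl logz).s2.cR * epsOfRecord (theta13OfThm1CCMWZB F 2 j γ εbg ε₀ ε₂₉ B₃ B₃' a₀ a₁ Efl logz).ν (gOfRecord₁₃ F 2 (theta13OfThm1CCMWZB F 2 j γ εbg ε₀ ε₂₉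 B₃ B₃' a₀ a₁ Efl logz) p) (m + 1)))
    (hcompRev : ∀ (p : B12.RunParams) (n : ℕ), n ≤ p.K → Step.InInterval (theta13OfThm1CCMWZB F 2 j γ εbg ε₀ ε₂₉ B₃ B₃' a₀ a₁ Efl logz).γ n (gOfRecord₁₃ F 2 (theta13OfThm1CCMWZB F 2 j γ εbg ε₀ ε₂₉ B₃ B₃' a₀ a₁ Efl logz) p) → ∀ m, m < n →
      (theta13OfThm1CCMWZB F 2 j γ εbg ε₀ ε₂₉ B₃ B₃' a₀ a₁ Efl logz).s2.cR * epsOfRecord (theta13OfThm1CCMWZB F 2 j γ εbg ε₀ ε₂₉ B₃ B₃' a₀ a₁ Efl logz).ν (gOfRecord₁₃ F 2 (theta13OfThm1CCMWZB F 2 j γ εbg ε₀ ε₂₉ B₃ B₃' a₀ a₁ Efl logz) p) (m + 1) ≤ 2 * ((theta13OfThm1CCMWZB F 2 j γ εbg ε₀ ε₂₉ B₃ B₃' a₀ a₁ Efl logz).s2.cR * epsOfRecord (theta13OfThm1CCMWZB F 2 j γ εbg ε₀ ε₂₉ B₃ B₃' a₀ a₁ Efl logz).ν (gOfRecord₁₃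 F 2 (theta13OfThm1CCMWZB F 2 j γ εbg ε₀ ε₂₉ B₃ B₃' a₀ a₁ Efl logz) p) m)) :
    ∃ θ : Stage13HParams F 2, θ.Provisos₁₃SepCoPH F 2 ∧ (θ.ZhUnity F 2 ∧ θ.SlotsNondegenerate₁₃ F 2) ∧ θ.Admissible F 2 :=
  exists_k0SepCoPH_thm1CCMWZB_gridGuard_of_thm1RegSepCoP7MG_of_thm1GaugeG_of_hcomp_allTorus F hγ0 hγ hbg hε hε' hB hB' ha₀ ha₁ hc hc₀ hc₁ h15
    (variationalThm1GaugeRegSepCoP7MG_of_gauge9TopStepG h9) hcomp hcompRev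


/-- **★★ THE ⁷ K0 BODY FROM THE (8)-STEP SENTENCE UNDER THE CANDIDATE GUARD** — what V21-G's stub 1-G‴ displays (`Prop8RegSepTopStepG F 2 suppDom Adm B₃ a₀ a₁` at the
four-conjunct `Adm`), through dag-n07-e module 53's guard-generic bridge `variationalThm1RegSepCoP7MG_of_prop8TopStepG` and the closer above.  CONDITIONAL on the two sentences;
NOT a registered text; K0⁷ OPEN. [cite: Balaban1985Variational, Thm 1 (8)–(9) p.279, Prop. 8 p.304, p.304 lines 1–2; Balaban1988Convergent, Thm 1 p.262, (2.1) p.254, p.257; Balaban1987RG1, (0.1) p.251] -/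
theorem exists_k0SepCoPH_thm1CCMWZB_gridGuard_of_prop8TopStepG_of_gauge9TopStepG_of_hcomp_allTorus (F : T4Family) (hγ0 : 0 < γ) (hγ : γ ≤ 1 / 2) (hbg : 0 < εbg) (hε : 0 < ε₀) (hε' : 0 < ε₂₉)
    (hB : 0 < B₃) (hB' : 0 ≤ B₃') (ha₀ : 0 < a₀) (ha₁ : 0 < a₁) (hc : c ≤ F.L ^ j) (hc₀ : c₀ ≤ j + 1) (hc₁ : c₁ ≤ j)
    (h8 : Prop8RegSepTopStepG F 2 (fun ν K Ω => suppDomOfRecord F ν K Ω) (fun ν M g K k _s => c ≤ ν.M₁ ∧ k + c₀ ≤ F.m + K ∧ F.L ^ c₁ ∣ M ∧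
      ∀ i, 1 ≤ i → i ≤ k → dCubeSide (F.P K).L M (RkOfRecord (F.P K).L ν.r (g i)) i ∣ (F.P K).sitesPerDir 0) B₃ a₀ a₁)
    (h9 : Gauge9RegSepTopStepG F 2 (fun ν K Ω => suppDomOfRecord F ν K Ω) (F.L ^ j) (fun ν M g K k _s => c ≤ ν.M₁ ∧ k + c₀ ≤ F.m + K ∧ F.L ^ c₁ ∣ M ∧
      ∀ i, 1 ≤ i → i ≤ k → dCubeSide (F.P K).L M (RkOfRecord (F.P K).L ν.r (g i)) i ∣ (F.P K).sitesPerDir 0) B₃ B₃' a₀ a₁)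
    (hcomp : ∀ (p : B12.RunParams) (n : ℕ), n ≤ p.K → Step.InInterval (theta13OfThm1CCMWZB F 2 j γ εbg ε₀ ε₂₉ B₃ B₃' a₀ a₁ Efl logz).γ n (gOfRecord₁₃ F 2 (theta13OfThm1CCMWZB F 2 j γ εbg ε₀ ε₂₉ B₃ B₃' a₀ a₁ Efl logz) p) → ∀ m, m < n →
      (theta13OfThm1CCMWZB F 2 j γ εbg ε₀ ε₂₉ B₃ B₃' a₀ a₁ Efl logz).s2.cR * epsOfRecord (theta13OfThm1CCMWZB F 2 j γ εbg ε₀ ε₂₉ B₃ B₃' a₀ a₁ Efl logz).ν (gOfRecord₁₃ F 2 (theta13OfThm1CCMWZB F 2 j γ εbg ε₀ ε₂₉ B₃ B₃' a₀ a₁ Efl logz) p) m ≤ 2 * ((theta13OfThm1CCMWZB F 2 j γ εbg ε₀ ε₂₉ B₃ B₃' a₀ a₁ Efl logz).s2.cR * epsOfRecord (theta13OfThm1CCMWZB F 2 j γ εbg ε₀ ε₂₉ B₃ B₃' a₀ a₁ Efl logz).ν (gOfRecord₁₃ F 2 (theta13OfThm1CCMWZB F 2 j γ εbg ε₀ ε₂₉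 B₃ B₃' a₀ a₁ Efl logz) p) (m + 1)))
    (hcompRev : ∀ (p : B12.RunParams) (n : ℕ), n ≤ p.K → Step.InInterval (theta13OfThm1CCMWZB F 2 j γ εbg ε₀ ε₂₉ B₃ B₃' a₀ a₁ Efl logz).γ n (gOfRecord₁₃ F 2 (theta13OfThm1CCMWZB F 2 j γ εbg ε₀ ε₂₉ B₃ B₃' a₀ a₁ Efl logz) p) → ∀ m, m < n →
      (theta13OfThm1CCMWZB F 2 j γ εbg ε₀ ε₂₉ B₃ B₃' a₀ a₁ Efl logz).s2.cR * epsOfRecord (theta13OfThm1CCMWZB F 2 j γ εbg ε₀ ε₂₉ B₃ B₃' a₀ a₁ Efl logz).ν (gOfRecord₁₃ F 2 (theta13OfThm1CCMWZB F 2 j γ εbg ε₀ ε₂₉ B₃ B₃' a₀ a₁ Efl logz) p) (m + 1) ≤ 2 * ((theta13OfThm1CCMWZB F 2 j γ εbg ε₀ ε₂₉ B₃ B₃' a₀ a₁ Efl logz).s2.cR * epsOfRecord (theta13OfThm1CCMWZB F 2 j γ εbg ε₀ ε₂₉ B₃ B₃' a₀ a₁ Efl logz).ν (gOfRecord₁₃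 F 2 (theta13OfThm1CCMWZB F 2 j γ εbg ε₀ ε₂₉ B₃ B₃' a₀ a₁ Efl logz) p) m)) :
    ∃ θ : Stage13HParams F 2, θ.Provisos₁₃SepCoPH F 2 ∧ (θ.ZhUnity F 2 ∧ θ.SlotsNondegenerate₁₃ F 2) ∧ θ.Admissible F 2 :=
  exists_k0SepCoPH_thm1CCMWZB_gridGuard_of_thm1RegSepCoP7MG_of_gauge9TopStepG_of_hcomp_allTorus F hγ0 hγ hbg hε hε' hB.le hB' ha₀ ha₁ hc hc₀ hc₁
    (variationalThm1RegSepCoP7MG_of_prop8TopStepG hB h8) h9 hcomp hcompRev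

end ClosersGridGuardZB

/-! ## §3  ONE abs β-box of the half-window Z3 member `θ₁₅ᶜᶜᴹᵂᶻᴮ(j; ½; εbg)` ⟹ the sign-free clauses (hcomp) ∧ (hcompRev) at `θ₁₅ᶜᶜᴹᵂᶻᴮ(j; γ; εbg)` — p589753 §1's
`clausesH_of_absBox` at Z3: the β-generic window shrink `exists_window_letters_signFree` (node O P3 g48 ∕ dag-n21-c) then A2ʷ-ZB §6′ `hcompBoth_theta13OfThm1CCMWZB_of_betaBoxSignFree_half` -/

section ClausesZB

variable (F : T4Family) (j : ℕ) {εbg B₃ B₃' a₀ a₁ : ℝ} {Efl logz : B12.RunParams → ℕ → ℝ}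

/-- **ONE ABS β-BOX OF `θ₁₅ᶜᶜᴹᵂᶻᴮ(j; ½; εbg; ε₀, ε₂₉)` ⟹ THE SIGN-FREE CLAUSES AT `θ₁₅ᶜᶜᴹᵂᶻᴮ(j; γ; εbg)` FOR SOME WINDOW `γ ∈ ]0, ½]`** (thresholds chosen with the box; `0 ≤ B₃, B₃′, a₀, a₁`):
`0 ≤ β′` read off the box at `k = 0`, the window shrink `exists_window_letters_signFree`, then A2ʷ-ZB §6′ on the restricted box.  No (8)∕(9) token is read.  CONDITIONAL on the box;
the box is about the β of THE Z3 MEMBER (radius `εbg`), not about the `εbg = 1` witnesses of record (DEF-1 g27 `K1ZBWitnessBetaRadius`: no `rfl` bridge between radii).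
[cite: Balaban1987RG1, Thm 1 p.259, (0.20)–(0.21) p.256, (1.20)–(1.22) p.264, §1 p.264; Balaban1988Convergent, (2.4)–(2.8) pp.255–256] -/
theorem clausesH_of_absBoxZB (hB : 0 ≤ B₃) (hB' : 0 ≤ B₃') (ha₀ : 0 ≤ a₀) (ha₁ : 0 ≤ a₁)
    (h : ∃ γ₀ ε₀ ε₂₉ β' : ℝ, 0 < γ₀ ∧ 0 < ε₀ ∧ 0 < ε₂₉ ∧
        BetaLowerH (-β') γ₀ (betaOfRecord₁₃ F 2 (theta13OfThm1CCMWZB F 2 j (1 / 2) εbg ε₀ ε₂₉ B₃ B₃' a₀ a₁ Efl logz)) ∧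
        BetaUpperH β' γ₀ (betaOfRecord₁₃ F 2 (theta13OfThm1CCMWZB F 2 j (1 / 2) εbg ε₀ ε₂₉ B₃ B₃' a₀ a₁ Efl logz))) :
    ∃ γ ε₀ ε₂₉ : ℝ, 0 < γ ∧ γ ≤ 1 / 2 ∧ 0 < ε₀ ∧ 0 < ε₂₉ ∧
        (∀ (p : B12.RunParams) (n : ℕ), n ≤ p.K → Step.InInterval (theta13OfThm1CCMWZB F 2 j γ εbg ε₀ ε₂₉ B₃ B₃' a₀ a₁ Efl logz).γ n (gOfRecord₁₃ F 2 (theta13OfThm1CCMWZB F 2 j γ εbg ε₀ ε₂₉ B₃ B₃' a₀ a₁ Efl logz) p) → ∀ m, m < n →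
          (theta13OfThm1CCMWZB F 2 j γ εbg ε₀ ε₂₉ B₃ B₃' a₀ a₁ Efl logz).s2.cR * epsOfRecord (theta13OfThm1CCMWZB F 2 j γ εbg ε₀ ε₂₉ B₃ B₃' a₀ a₁ Efl logz).ν (gOfRecord₁₃ F 2 (theta13OfThm1CCMWZB F 2 j γ εbg ε₀ ε₂₉ B₃ B₃' a₀ a₁ Efl logz) p) m ≤
            2 * ((theta13OfThm1CCMWZB F 2 j γ εbg ε₀ ε₂₉ B₃ B₃' a₀ a₁ Efl logz).s2.cR * epsOfRecord (theta13OfThm1CCMWZB F 2 j γ εbg ε₀ ε₂₉ B₃ B₃' a₀ a₁ Efl logz).ν (gOfRecord₁₃ F 2 (theta13OfThm1CCMWZB F 2 j γ εbg ε₀ ε₂₉ B₃ B₃' a₀ a₁ Efl logz) p) (m + 1))) ∧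
        (∀ (p : B12.RunParams) (n : ℕ), n ≤ p.K → Step.InInterval (theta13OfThm1CCMWZB F 2 j γ εbg ε₀ ε₂₉ B₃ B₃' a₀ a₁ Efl logz).γ n (gOfRecord₁₃ F 2 (theta13OfThm1CCMWZB F 2 j γ εbg ε₀ ε₂₉ B₃ B₃' a₀ a₁ Efl logz) p) → ∀ m, m < n →
          (theta13OfThm1CCMWZB F 2 j γ εbg ε₀ ε₂₉ B₃ B₃' a₀ a₁ Efl logz).s2.cR * epsOfRecord (theta13OfThm1CCMWZB F 2 j γ εbg ε₀ ε₂₉ B₃ B₃' a₀ a₁ Efl logz).ν (gOfRecord₁₃ F 2 (theta13OfThm1CCMWZB F 2 j γ εbg ε₀ ε₂₉ B₃ B₃' a₀ a₁ Efl logz) p) (m + 1) ≤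
            2 * ((theta13OfThm1CCMWZB F 2 j γ εbg ε₀ ε₂₉ B₃ B₃' a₀ a₁ Efl logz).s2.cR * epsOfRecord (theta13OfThm1CCMWZB F 2 j γ εbg ε₀ ε₂₉ B₃ B₃' a₀ a₁ Efl logz).ν (gOfRecord₁₃ F 2 (theta13OfThm1CCMWZB F 2 j γ εbg ε₀ ε₂₉ B₃ B₃' a₀ a₁ Efl logz) p) m)) := by
  obtain ⟨γ₀, ε₀, ε₂₉, β', hγ0, hε, hε', hlow, hup⟩ := h
  have hv : (fun _ : Fin (0 + 1) => γ₀) ∈ Box γ₀ 0 := mem_box.mpr fun _ => ⟨hγ0, le_rfl⟩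
  have hβ' : 0 ≤ β' := by
    have h1 := hlow 0 _ hv
    have h2 := hup 0 _ hv
    linarith
  obtain ⟨γ, hγpos, hγle, hγhalf, hl, hu⟩ := exists_window_letters_signFree hγ0 hβ'
  exact ⟨γ, ε₀, ε₂₉, hγpos, hγhalf, hε, hε',
    hcompBoth_theta13OfThm1CCMWZB_of_betaBoxSignFree_half hγhalf hB hB' ha₀ ha₁ (fun k v hv => hlow k v (box_mono hγle k hv))
      (fun k v hv => hup k v (box_mono hγle k hv)) hl hu⟩

end ClausesZB

/-! ## §4  PART 1-G‴ AT THE Z3 MEMBER: the body at an arbitrary cube letter, the stub-level composition with a GENERIC (9)-supplier (box at `εbg := a₀`), NODE O's socket -/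

section Part1GridGuardedZB

variable {Efl logz : B12.RunParams → ℕ → ℝ}

/-- **★ THE ⁷ K0 BODY FOR `F` AT AN ARBITRARY CUBE LETTER `(L^j, c, c₀, c₁)` WITH `c ≤ L^j`, `c₀ ≤ j + 1`, `c₁ ≤ j`, FROM THE (8)-SENTENCE AND THE (9)-TOKEN UNDER `A‴` AND ONE ABS
β-BOX OF `θ₁₅ᶜᶜᴹᵂᶻᴮ(j; ½; εbg)`** — k0-s1-w3's `exists_k0H_of_thm1CoP7MG3_of_gauge9G3_of_absBox` at Z3: §3's `clausesH_of_absBoxZB` (token-free) gives (hcomp) ∧ (hcompRev) at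
`θ₁₅ᶜᶜᴹᵂᶻᴮ(j; γ; εbg)`, then §2.  CONDITIONAL. [cite: Balaban1985Variational, Thm 1 (8)–(9) p.279, (144)–(152) pp.300–301, Prop. 8 p.304, p.304 lines 1–2; Balaban1988Convergent, Thm 1 p.262, (2.1) p.254, (2.5)–(2.8) pp.255–256, p.257, (2.21) p.258; Balaban1987RG1, Thm 1 p.259, (0.1) p.251, (1.12) p.262, §1 p.264] -/
theorem exists_k0H_of_thm1CoP7MG3_of_gauge9G3_of_absBoxZB (F : T4Family) {j c c₀ c₁ : ℕ} (hc : c ≤ F.L ^ j) (hc₀ : c₀ ≤ j + 1) (hc₁ : c₁ ≤ j) {εbg B₃ B₉ a₀ a₁ : ℝ} (hbg : 0 < εbg) (hB₃ : 0 ≤ B₃) (hB₉ : 0 ≤ B₉)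
    (ha₀ : 0 < a₀) (ha₁ : 0 < a₁) (h15 : VariationalThm1RegSepCoP7MG F 2 (fun ν M g K k _s => c ≤ ν.M₁ ∧ k + c₀ ≤ F.m + K ∧ F.L ^ c₁ ∣ M ∧
      ∀ i, 1 ≤ i → i ≤ k → dCubeSide (F.P K).L M (RkOfRecord (F.P K).L ν.r (g i)) i ∣ (F.P K).sitesPerDir 0) B₃ a₀ a₁)
    (h9 : Gauge9RegSepTopStepG F 2 (fun ν K Ω => suppDomOfRecord F ν K Ω) (F.L ^ j) (fun ν M g K k _s => c ≤ ν.M₁ ∧ k + c₀ ≤ F.m + K ∧ F.L ^ c₁ ∣ M ∧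
      ∀ i, 1 ≤ i → i ≤ k → dCubeSide (F.P K).L M (RkOfRecord (F.P K).L ν.r (g i)) i ∣ (F.P K).sitesPerDir 0) B₃ B₉ a₀ a₁)
    (h3A : ∃ γ₀ ε₀ ε₂₉ β' : ℝ, 0 < γ₀ ∧ 0 < ε₀ ∧ 0 < ε₂₉ ∧
        BetaLowerH (-β') γ₀ (betaOfRecord₁₃ F 2 (theta13OfThm1CCMWZB F 2 j (1 / 2) εbg ε₀ ε₂₉ B₃ B₉ a₀ a₁ Efl logz)) ∧
        BetaUpperH β' γ₀ (betaOfRecord₁₃ F 2 (theta13OfThm1CCMWZB F 2 j (1 / 2) εbg ε₀ ε₂₉ B₃ B₉ a₀ a₁ Efl logz))) :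
    ∃ θ : Stage13HParams F 2, θ.Provisos₁₃SepCoPH F 2 ∧ (θ.ZhUnity F 2 ∧ θ.SlotsNondegenerate₁₃ F 2) ∧ θ.Admissible F 2 := by
  obtain ⟨γ, ε₀, ε₂₉, hγ0, hγ, hε, hε', hcomp, hcompRev⟩ := clausesH_of_absBoxZB F j hB₃ hB₉ ha₀.le ha₁.le h3A
  exact exists_k0SepCoPH_thm1CCMWZB_gridGuard_of_thm1RegSepCoP7MG_of_gauge9TopStepG_of_hcomp_allTorus F hγ0 hγ hbg hε hε' hB₃ hB₉ ha₀ ha₁ hc hc₀ hc₁ h15 h9 hcomp hcompRev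

/-- **★★ K0⁷'s BODY AT EVERY FAMILY FROM THE CANDIDATE STUB 1-G‴, A GENERIC (9)-SUPPLIER UNDER `A‴`, AND THE CANDIDATE 3ᴬ′-G‴** — k0-s1-w3's
`record13SepCoPHBody_of_stub1G3_of_gauge9SupplierG3_of_absBetaBoxAtG3` with the 3ᴬ′ box read at the Z3 member `εbg := a₀` (proof VERBATIM otherwise: stub 1 ⇒ the guarded (8)
`CoP` sentence by module 53, ceiling shrunk by `.of_le`, guard refined `(c, c₀, c₁) → (c′, c₀, c₁)` by `.of_imp`; `hSG` ⇒ (9); `h3A'G` ⇒ the box ⇒ §1's first theorem).  CONDITIONAL; the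
texts here are stub 1-G‴ of V21-G (REGISTERED) and the 3ᴬ′-G‴ text RE-READ AT THE Z3 MEMBER (plan g91 K0-AT-Z3 word 2026-08-29 07:15Z: the V22-Z CANDIDATE, NOT registered); K0⁷ NOT closed; nothing of Bałaban asserted.
[cite: Balaban1985Variational, Thm 1 (8)–(9) p.279, (144)–(152) pp.300–301, Prop. 8 p.304, p.304 lines 1–2; Balaban1985RegularSpaces, (1.3)–(1.6) p.77, Prop. 6 p.99; Balaban1988Convergent, Thm 1 p.262, (2.1) p.254, (2.5)–(2.8) pp.255–256, p.257; Balaban1987RG1, Thm 1 p.259, (0.1) p.251, §1 p.264] -/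
theorem record13SepCoPHBody_of_stub1G3_of_gauge9SupplierG3_of_absBetaBoxAtG3ZB
    (h1G : ∀ F : T4Family, ∃ (c c₀ c₁ : ℕ) (B₃ a₀ a₁ : ℝ), 2 * (F.L : ℝ) ^ 2 ≤ B₃ ∧ 0 < a₀ ∧ 0 < a₁ ∧
      Prop8RegSepTopStepG F 2 (fun ν K Ω => suppDomOfRecord F ν K Ω) (fun ν M g K k _s => c ≤ ν.M₁ ∧ k + c₀ ≤ F.m + K ∧ F.L ^ c₁ ∣ M ∧
      ∀ i, 1 ≤ i → i ≤ k → dCubeSide (F.P K).L M (RkOfRecord (F.P K).L ν.r (g i)) i ∣ (F.P K).sitesPerDir 0) B₃ a₀ a₁)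
    (hSG : ∀ (F : T4Family) (c c₀ c₁ : ℕ) (B₃ a₀ a₁ : ℝ), 2 * (F.L : ℝ) ^ 2 ≤ B₃ → 0 < a₀ → 0 < a₁ →
      Prop8RegSepTopStepG F 2 (fun ν K Ω => suppDomOfRecord F ν K Ω) (fun ν M g K k _s => c ≤ ν.M₁ ∧ k + c₀ ≤ F.m + K ∧ F.L ^ c₁ ∣ M ∧
      ∀ i, 1 ≤ i → i ≤ k → dCubeSide (F.P K).L M (RkOfRecord (F.P K).L ν.r (g i)) i ∣ (F.P K).sitesPerDir 0) B₃ a₀ a₁ →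
      ∃ (j c' : ℕ) (B₉ a₁' : ℝ), c ≤ c' ∧ c' ≤ F.L ^ j ∧ c₀ ≤ j + 1 ∧ c₁ ≤ j ∧ 0 < B₉ ∧ 0 < a₁' ∧ a₁' ≤ a₁ ∧
        Gauge9RegSepTopStepG F 2 (fun ν K Ω => suppDomOfRecord F ν K Ω) (F.L ^ j) (fun ν M g K k _s => c' ≤ ν.M₁ ∧ k + c₀ ≤ F.m + K ∧ F.L ^ c₁ ∣ M ∧
      ∀ i, 1 ≤ i → i ≤ k → dCubeSide (F.P K).L M (RkOfRecord (F.P K).L ν.r (g i)) i ∣ (F.P K).sitesPerDir 0) B₃ B₉ a₀ a₁')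
    (h3A'G : ∀ (F : T4Family) (j c c₀ c₁ : ℕ) (B₃ B₃' a₀ a₁ : ℝ), c ≤ F.L ^ j → c₀ ≤ j + 1 → c₁ ≤ j → 2 * (F.L : ℝ) ^ 2 ≤ B₃ → 0 < B₃' → 0 < a₀ → 0 < a₁ →
      VariationalThm1RegSepCoP7MG F 2 (fun ν M g K k _s => c ≤ ν.M₁ ∧ k + c₀ ≤ F.m + K ∧ F.L ^ c₁ ∣ M ∧
      ∀ i, 1 ≤ i → i ≤ k → dCubeSide (F.P K).L M (RkOfRecord (F.P K).L ν.r (g i)) i ∣ (F.P K).sitesPerDir 0) B₃ a₀ a₁ →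
      Gauge9RegSepTopStepG F 2 (fun ν K Ω => suppDomOfRecord F ν K Ω) (F.L ^ j) (fun ν M g K k _s => c ≤ ν.M₁ ∧ k + c₀ ≤ F.m + K ∧ F.L ^ c₁ ∣ M ∧
      ∀ i, 1 ≤ i → i ≤ k → dCubeSide (F.P K).L M (RkOfRecord (F.P K).L ν.r (g i)) i ∣ (F.P K).sitesPerDir 0) B₃ B₃' a₀ a₁ →
      ∃ γ₀ ε₀ ε₂₉ β' : ℝ, 0 < γ₀ ∧ 0 < ε₀ ∧ 0 < ε₂₉ ∧
        BetaLowerH (-β') γ₀ (betaOfRecord₁₃ F 2 (theta13OfThm1CCMWZB F 2 j (1 / 2) a₀ ε₀ ε₂₉ B₃ B₃' a₀ a₁ Efl logz)) ∧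
        BetaUpperH β' γ₀ (betaOfRecord₁₃ F 2 (theta13OfThm1CCMWZB F 2 j (1 / 2) a₀ ε₀ ε₂₉ B₃ B₃' a₀ a₁ Efl logz))) :
    ∀ F : T4Family, ∃ θ : Stage13HParams F 2, θ.Provisos₁₃SepCoPH F 2 ∧ (θ.ZhUnity F 2 ∧ θ.SlotsNondegenerate₁₃ F 2) ∧ θ.Admissible F 2 := by
  intro F
  obtain ⟨c, c₀, c₁, B₃, a₀, a₁, hB₃, ha₀, ha₁, h8⟩ := h1G F
  have hL : (0 : ℝ) < (F.L : ℝ) := by exact_mod_cast lt_trans Nat.zero_lt_one F.hL.2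
  have hBpos : (0 : ℝ) < B₃ := lt_of_lt_of_le (mul_pos two_pos (pow_pos hL 2)) hB₃
  obtain ⟨j, c', B₉, a₁', hcc', hc', hc₀, hc₁, hB₉, ha₁', ha₁'le, h9⟩ := hSG F c c₀ c₁ B₃ a₀ a₁ hB₃ ha₀ ha₁ h8
  have h15 : VariationalThm1RegSepCoP7MG F 2 (fun ν M g K k _s => c' ≤ ν.M₁ ∧ k + c₀ ≤ F.m + K ∧ F.L ^ c₁ ∣ M ∧
      ∀ i, 1 ≤ i → i ≤ k → dCubeSide (F.P K).L M (RkOfRecord (F.P K).L ν.r (g i)) i ∣ (F.P K).sitesPerDir 0) B₃ a₀ a₁' :=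
    (variationalThm1RegSepCoP7MG_of_prop8TopStepG hBpos (h8.of_le le_rfl ha₁'le)).of_imp fun _ _ _ _ _ _ h => ⟨hcc'.trans h.1, h.2⟩
  exact exists_k0H_of_thm1CoP7MG3_of_gauge9G3_of_absBoxZB F hc' hc₀ hc₁ ha₀ hBpos.le hB₉.le ha₀ ha₁' h15 h9
    (h3A'G F j c' c₀ c₁ B₃ B₉ a₀ a₁' hc' hc₀ hc₁ hB₃ hB₉ ha₀ ha₁' h15 h9)

/-- **NODE O's JETS-FREE PAIR AT THE HALF-WINDOW Z3 MEMBER `θ₁₅ᶜᶜᴹᵂᶻᴮ(j; ½; εbg)` SUPPLIES THE CANDIDATE 3ᴬ′-G‴ AT THE CUBE LETTER `(j, c, c₀, c₁)`** — k0-s1-w3's `absBetaBoxAtG3_of_jetsFreePairAtG3` with the pair and the box read AT THE Z3 MEMBER; N26's `exists_betaBox_betaOfRecord₁₃_of_jetsFreePair` is θ-generic, so the proof is the same three lines.  CONDITIONAL on the pair; NOT proved; nothing asserted.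
[cite: Balaban1987RG1, Thm 2 p.259, §1 p.264, (2.12)–(2.14) p.268, (5.10) p.293; Balaban1988RG2Cluster, Lemma 3 (2.38) p.20; Balaban1985Variational, Thm 1 p.279, Prop. 8 p.304, p.304 lines 1–2] -/
theorem absBetaBoxAtG3ZB_of_jetsFreePairAtG3ZB (F : T4Family) (j c c₀ c₁ : ℕ)
    (h : ∀ B₃ B₃' a₀ a₁ : ℝ, 2 * (F.L : ℝ) ^ 2 ≤ B₃ → 0 < B₃' → 0 < a₀ → 0 < a₁ →
      VariationalThm1RegSepCoP7MG F 2 (fun ν M g K k _s => c ≤ ν.M₁ ∧ k + c₀ ≤ F.m + K ∧ F.L ^ c₁ ∣ M ∧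
      ∀ i, 1 ≤ i → i ≤ k → dCubeSide (F.P K).L M (RkOfRecord (F.P K).L ν.r (g i)) i ∣ (F.P K).sitesPerDir 0) B₃ a₀ a₁ →
      Gauge9RegSepTopStepG F 2 (fun ν K Ω => suppDomOfRecord F ν K Ω) (F.L ^ j) (fun ν M g K k _s => c ≤ ν.M₁ ∧ k + c₀ ≤ F.m + K ∧ F.L ^ c₁ ∣ M ∧
      ∀ i, 1 ≤ i → i ≤ k → dCubeSide (F.P K).L M (RkOfRecord (F.P K).L ν.r (g i)) i ∣ (F.P K).sitesPerDir 0) B₃ B₃' a₀ a₁ →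
      ∃ ε₀ ε₂₉ : ℝ, 0 < ε₀ ∧ 0 < ε₂₉ ∧
        (letI := (theta13OfThm1CCMWZB F 2 j (1 / 2) a₀ ε₀ ε₂₉ B₃ B₃' a₀ a₁ Efl logz).instVβ₁; letI := (theta13OfThm1CCMWZB F 2 j (1 / 2) a₀ ε₀ ε₂₉ B₃ B₃' a₀ a₁ Efl logz).instVβ₂;
         letI := (theta13OfThm1CCMWZB F 2 j (1 / 2) a₀ ε₀ ε₂₉ B₃ B₃' a₀ a₁ Efl logz).instιβ
         ∃ d A : ℝ, 0 ≤ d ∧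
           OneLoopDrift d A (beta0OfMerged (betaMerged F (mergedTermFamilyMatT F 2 (TcanOfRecord F 2)
             (chiFixed29 F 2 (theta13OfThm1CCMWZB F 2 j (1 / 2) a₀ ε₀ ε₂₉ B₃ B₃' a₀ a₁ Efl logz).ν (theta13OfThm1CCMWZB F 2 j (1 / 2) a₀ ε₀ ε₂₉ B₃ B₃' a₀ a₁ Efl logz).ε₂₉) (theta13OfThm1CCMWZB F 2 j (1 / 2) a₀ ε₀ ε₂₉ B₃ B₃' a₀ a₁ Efl logz).εbg)
             (theta13OfThm1CCMWZB F 2 j (1 / 2) a₀ ε₀ ε₂₉ B₃ B₃' a₀ a₁ Efl logz).ρ8 (theta13OfThm1CCMWZB F 2 j (1 / 2) a₀ ε₀ ε₂₉ B₃ B₃' a₀ a₁ Efl logz).bV) (theta13OfThm1CCMWZB F 2 j (1 / 2) a₀ ε₀ ε₂₉ B₃ B₃' a₀ a₁ Efl logz).v₀) ∧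
           ∃ γ₀ : ℝ, 0 < γ₀ ∧ γ₀ ≤ (theta13OfThm1CCMWZB F 2 j (1 / 2) a₀ ε₀ ε₂₉ B₃ B₃' a₀ a₁ Efl logz).γ ∧
             AtSlopeCont
               (oneLoopSplit_betaOfMerged
                 (betaMerged F (mergedTermFamilyMatT F 2 (TcanOfRecord F 2)
                   (chiFixed29 F 2 (theta13OfThm1CCMWZB F 2 j (1 / 2) a₀ ε₀ ε₂₉ B₃ B₃' a₀ a₁ Efl logz).ν (theta13OfThm1CCMWZB F 2 j (1 / 2) a₀ ε₀ ε₂₉ B₃ B₃' a₀ a₁ Efl logz).ε₂₉) (theta13OfThm1CCMWZB F 2 j (1 / 2) a₀ ε₀ ε₂₉ B₃ B₃' a₀ a₁ Efl logz).εbg)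
                   (theta13OfThm1CCMWZB F 2 j (1 / 2) a₀ ε₀ ε₂₉ B₃ B₃' a₀ a₁ Efl logz).ρ8 (theta13OfThm1CCMWZB F 2 j (1 / 2) a₀ ε₀ ε₂₉ B₃ B₃' a₀ a₁ Efl logz).bV)
                 (beta0OfMerged (betaMerged F (mergedTermFamilyMatT F 2 (TcanOfRecord F 2)
                   (chiFixed29 F 2 (theta13OfThm1CCMWZB F 2 j (1 / 2) a₀ ε₀ ε₂₉ B₃ B₃' a₀ a₁ Efl logz).ν (theta13OfThm1CCMWZB F 2 j (1 / 2) a₀ ε₀ ε₂₉ B₃ B₃' a₀ a₁ Efl logz).ε₂₉) (theta13OfThm1CCMWZB F 2 j (1 / 2) a₀ ε₀ ε₂₉ B₃ B₃' a₀ a₁ Efl logz).εbg)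
                   (theta13OfThm1CCMWZB F 2 j (1 / 2) a₀ ε₀ ε₂₉ B₃ B₃' a₀ a₁ Efl logz).ρ8 (theta13OfThm1CCMWZB F 2 j (1 / 2) a₀ ε₀ ε₂₉ B₃ B₃' a₀ a₁ Efl logz).bV) (theta13OfThm1CCMWZB F 2 j (1 / 2) a₀ ε₀ ε₂₉ B₃ B₃' a₀ a₁ Efl logz).v₀)
                 (theta13OfThm1CCMWZB F 2 j (1 / 2) a₀ ε₀ ε₂₉ B₃ B₃' a₀ a₁ Efl logz).γ)
               γ₀ d)) :
    ∀ B₃ B₃' a₀ a₁ : ℝ, 2 * (F.L : ℝ) ^ 2 ≤ B₃ → 0 < B₃' → 0 < a₀ → 0 < a₁ →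
      VariationalThm1RegSepCoP7MG F 2 (fun ν M g K k _s => c ≤ ν.M₁ ∧ k + c₀ ≤ F.m + K ∧ F.L ^ c₁ ∣ M ∧
      ∀ i, 1 ≤ i → i ≤ k → dCubeSide (F.P K).L M (RkOfRecord (F.P K).L ν.r (g i)) i ∣ (F.P K).sitesPerDir 0) B₃ a₀ a₁ →
      Gauge9RegSepTopStepG F 2 (fun ν K Ω => suppDomOfRecord F ν K Ω) (F.L ^ j) (fun ν M g K k _s => c ≤ ν.M₁ ∧ k + c₀ ≤ F.m + K ∧ F.L ^ c₁ ∣ M ∧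
      ∀ i, 1 ≤ i → i ≤ k → dCubeSide (F.P K).L M (RkOfRecord (F.P K).L ν.r (g i)) i ∣ (F.P K).sitesPerDir 0) B₃ B₃' a₀ a₁ →
      ∃ γ₀ ε₀ ε₂₉ β' : ℝ, 0 < γ₀ ∧ 0 < ε₀ ∧ 0 < ε₂₉ ∧
        BetaLowerH (-β') γ₀ (betaOfRecord₁₃ F 2 (theta13OfThm1CCMWZB F 2 j (1 / 2) a₀ ε₀ ε₂₉ B₃ B₃' a₀ a₁ Efl logz)) ∧
        BetaUpperH β' γ₀ (betaOfRecord₁₃ F 2 (theta13OfThm1CCMWZB F 2 j (1 / 2) a₀ ε₀ ε₂₉ B₃ B₃' a₀ a₁ Efl logz)) := by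
  intro B₃ B₃' a₀ a₁ hB₃ hB₃' ha₀ ha₁ h15 h9
  obtain ⟨ε₀, ε₂₉, hε, hε', hJ⟩ := h B₃ B₃' a₀ a₁ hB₃ hB₃' ha₀ ha₁ h15 h9
  obtain ⟨γ₀, hγ0, -, β', -, hup, hlow, -⟩ := exists_betaBox_betaOfRecord₁₃_of_jetsFreePair F 2 (theta13OfThm1CCMWZB F 2 j (1 / 2) a₀ ε₀ ε₂₉ B₃ B₃' a₀ a₁ Efl logz) hJ
  exact ⟨γ₀, ε₀, ε₂₉, β', hγ0, hε, hε', hlow, hup⟩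

end Part1GridGuardedZB

/-! ## §5  ★★★ The CANDIDATE V22-Z composition: V21-G's FILE 4‴ with 3ᴬ′-G‴'s box read at the Z3 member (`εbg := a₀`) — kernel check of the plan's one substitution -/

section CompositionGridGuardedZB

variable {Efl logz : B12.RunParams → ℕ → ℝ}

/-- **★★★ K0⁷'s BODY AT EVERY FAMILY FROM THE CANDIDATE STUB 1-G‴, STUB 2′ AND THE CANDIDATE 3ᴬ′-G‴** — `h1G3` = the V21-G candidate stub-1 text ([15] Prop. 8's top step at the
record's support selector under `A‴(c, c₀, c₁)` for SOME `(c, c₀, c₁)` and guarded `(B₃, a₀, a₁)`); `h2P` = STUB 2′ VERBATIM (landed p595104); `h3A'G3` = the 3ᴬ′-G‴ candidate (binders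
`(j c c₀ c₁)`, riders `c₀ ≤ j + 1`, `c₁ ≤ j`, both antecedents under `A‴`).  Proof: §2's supplier, then §1.  The shape a V21-G skeleton's `Record13SepCoPHInhabited_of h1G h2P h3A'G` would cite
BY NAME.  CONDITIONAL; the texts are CANDIDATES, NOT registered; K0⁷ NOT closed; nothing of Bałaban asserted; a re-text is not progress.
[cite: Balaban1985Variational, Thm 1 (8)–(9) p.279, (144)–(152) pp.300–301, Prop. 8 p.304, p.304 lines 1–2; Balaban1985RegularSpaces, (1.3)–(1.6) p.77, Prop. 6 p.99, p.98; Balaban1988Convergent, Thm 1 p.262, (2.1) p.254, (2.5)–(2.8) pp.255–256, p.257; Balaban1987RG1, Thm 1 p.259, (0.1) p.251, §1 p.264] -/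
theorem record13SepCoPHBody_of_stubs1G3_2P_3A'G3ZB
    (h1G : ∀ F : T4Family, ∃ (c c₀ c₁ : ℕ) (B₃ a₀ a₁ : ℝ), 2 * (F.L : ℝ) ^ 2 ≤ B₃ ∧ 0 < a₀ ∧ 0 < a₁ ∧
      Prop8RegSepTopStepG F 2 (fun ν K Ω => suppDomOfRecord F ν K Ω) (fun ν M g K k _s => c ≤ ν.M₁ ∧ k + c₀ ≤ F.m + K ∧ F.L ^ c₁ ∣ M ∧
      ∀ i, 1 ≤ i → i ≤ k → dCubeSide (F.P K).L M (RkOfRecord (F.P K).L ν.r (g i)) i ∣ (F.P K).sitesPerDir 0) B₃ a₀ a₁)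
    (h2P : ∀ F : T4Family, ∃ (ρ₀ : ℕ) (B₁ c₁ : ℝ), 1 ≤ ρ₀ ∧ 0 ≤ B₁ ∧ 0 < c₁ ∧
      (letI : CStarAlgebra (MatA 2) := {}; B8.Prop6Printed 4 (F.L : ℝ) B₁ c₁ (fun i : ZdIdx 4 F.L => zdCubP (MatA 2) F.L ρ₀ i)))
    (h3A'G : ∀ (F : T4Family) (j c c₀ c₁ : ℕ) (B₃ B₃' a₀ a₁ : ℝ), c ≤ F.L ^ j → c₀ ≤ j + 1 → c₁ ≤ j → 2 * (F.L : ℝ) ^ 2 ≤ B₃ → 0 < B₃' → 0 < a₀ → 0 < a₁ →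
      VariationalThm1RegSepCoP7MG F 2 (fun ν M g K k _s => c ≤ ν.M₁ ∧ k + c₀ ≤ F.m + K ∧ F.L ^ c₁ ∣ M ∧
      ∀ i, 1 ≤ i → i ≤ k → dCubeSide (F.P K).L M (RkOfRecord (F.P K).L ν.r (g i)) i ∣ (F.P K).sitesPerDir 0) B₃ a₀ a₁ →
      Gauge9RegSepTopStepG F 2 (fun ν K Ω => suppDomOfRecord F ν K Ω) (F.L ^ j) (fun ν M g K k _s => c ≤ ν.M₁ ∧ k + c₀ ≤ F.m + K ∧ F.L ^ c₁ ∣ M ∧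
      ∀ i, 1 ≤ i → i ≤ k → dCubeSide (F.P K).L M (RkOfRecord (F.P K).L ν.r (g i)) i ∣ (F.P K).sitesPerDir 0) B₃ B₃' a₀ a₁ →
      ∃ γ₀ ε₀ ε₂₉ β' : ℝ, 0 < γ₀ ∧ 0 < ε₀ ∧ 0 < ε₂₉ ∧
        BetaLowerH (-β') γ₀ (betaOfRecord₁₃ F 2 (theta13OfThm1CCMWZB F 2 j (1 / 2) a₀ ε₀ ε₂₉ B₃ B₃' a₀ a₁ Efl logz)) ∧
        BetaUpperH β' γ₀ (betaOfRecord₁₃ F 2 (theta13OfThm1CCMWZB F 2 j (1 / 2) a₀ ε₀ ε₂₉ B₃ B₃' a₀ a₁ Efl logz))) :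
    ∀ F : T4Family, ∃ θ : Stage13HParams F 2, θ.Provisos₁₃SepCoPH F 2 ∧ (θ.ZhUnity F 2 ∧ θ.SlotsNondegenerate₁₃ F 2) ∧ θ.Admissible F 2 :=
  record13SepCoPHBody_of_stub1G3_of_gauge9SupplierG3_of_absBetaBoxAtG3ZB h1G
    (fun F c c₀ c₁ B₃ a₀ a₁ hB₃ ha₀ ha₁ h8 => gauge9SupplierG3_of_prop6MemberP F (h2P F) c c₀ c₁ B₃ a₀ a₁ hB₃ ha₀ ha₁ h8) h3A'G

end CompositionGridGuardedZB

end Summit.QuantumFields.YangMills.Theorems.K0AllTorusOfStepTokensGuardedZB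

end
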